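import Mathlib
import HarnessLib
import Summits.Ventures.LatticeQCDFlow.Scoring.RareChangeAutocorrelation
import Summits.Ventures.LatticeQCDFlow.Scoring.SectorTimeAverageVarianceFloor
import Summits.Ventures.LatticeQCDFlow.Scoring.IMHAcceptanceRecord

/-!
# A frozen OBSERVABLE does not average: for ANY exact sampler, `|g| ≤ B` with stationary one-step
# change probability `≤ p` and `N ≪ 3 Var_π g/(2B²p)`: `Var[ḡ_N] ≥ Var_π g − 2B²p(N²−1)/(3N)` and the
# expected sample variance is `≤ 2B²p(N²−1)/(3N)`

HONEST FRAMING: exact (Metropolis-corrected) sampling algorithms for lattice gauge theory;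
figures of merit are autocorrelation/cost numbers at stated couplings and volumes; no
continuum-physics claim.

Venture `LatticeQCDFlow` (cell pub-lqcd), topic `Scoring`; FANOUT row 8 (`s0-cpn-nemc`, GEN-23).
NEW WORK of the cell, not a published result; no definition is introduced; nothing is cited as a
fact.  The observable version of `Scoring/SectorTimeAverageVarianceFloor` (sectors): compose this row's
`Scoring/RareChangeAutocorrelation.autocov_ge_of_changeProb` (`C_g(t) ≥ ∫g² dπ − 2B²tp` for ANY Markov
kernel with `π` invariant, `|g| ≤ B`, `(π ⊗ₘ κ){g x ≠ g y} ≤ p`) with the centring identity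
`C_{g−πg}(t) = C_g(t) − (πg)²` (`Scoring/IMHAcceptanceRecord.autocov_sub_const`) to get the normalised
linear floor `ρ_g(t) ≥ 1 − 2B²pt/Var_π g`, and feed it to
`Scoring/SectorTimeAverageVarianceFloor.variance_timeAverage_ge_of_acf_linear` /
`chain_integral_sampleVariance_le_of_acf_linear`.  RESULTS (stationary chain on path space, `N ≠ 0`,
`Var_π g ≠ 0`): **`Var[ḡ_N] ≥ Var_π g − 2B²p(N² − 1)/(3N)`** and **`E_π[v̂_N] ≤ 2B²p(N² − 1)/(3N)`**; in
theory-2's typed setting (`Scaling/TunnellingLaws`: a set `S` separating the charge `Q` along the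
a.s.-allowed move relation) with `p = 2π(S)` for every observable `φ ∘ Q` of the charge.  Reading: a run
of `N ≪ 3Var/(2B²p)` steps of ANY exact sampler whose charge changes with probability `≤ p` per step
estimates `π(φ∘Q)` as noisily as ONE equilibrium sample and shows a sample variance `≪ Var` — it looks
converged while frozen.

## Content

* **`autocov_centred_ge_of_changeProb`** — `Var_π g − 2B²pt ≤ C_{g−πg}(t)`;
  **`acf_ge_of_changeProb`** — `1 − (2B²p/Var_π g)·t ≤ ρ_g(t)`;
* **`variance_timeAverage_ge_of_changeProb`**, **`chain_integral_sampleVariance_le_of_changeProb`**;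
* **`variance_timeAverage_ge_of_separating`**, **`chain_integral_sampleVariance_le_of_separating`**.

NOT CLAIMED: non-stationary starts; the size of `p`; any number of ours.
-/

noncomputable section

namespace Summit.Ventures.LatticeQCDFlow.Scoring

open MeasureTheory ProbabilityTheory Filter Finset Summit.Ventures.LatticeQCDFlow.Exactness
open scoped ENNReal

variable {Ω : Type*} [MeasurableSpace Ω]

section Observable

variable {κ : Kernel Ω Ω} [IsMarkovKernel κ] {π : Measure Ω} [IsProbabilityMeasure π]

/-- **`Var_π g − 2B²p·t ≤ C_{g − πg}(t)`**: the centred autocovariance floor (`π` invariant, `|g| ≤ B`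
measurable, `(π ⊗ₘ κ){g x ≠ g y} ≤ ENNReal.ofReal p`, `0 ≤ p`). -/
theorem autocov_centred_ge_of_changeProb (hπ : Kernel.Invariant κ π) {g : Ω → ℝ} (hg : Measurable g)
    {B : ℝ} (hB : ∀ x, |g x| ≤ B) {p : ℝ} (hp : 0 ≤ p)
    (hchange : (π ⊗ₘ κ) {q : Ω × Ω | g q.1 ≠ g q.2} ≤ ENNReal.ofReal p) (t : ℕ) :
    autocov κ π (fun y => g y - ∫ z, g z ∂π) 0 - 2 * B ^ 2 * p * t
      ≤ autocov κ π (fun y => g y - ∫ z, g z ∂π) t := by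
  rw [autocov_sub_const hπ hg hB _ t, autocov_sub_const hπ hg hB _ 0, autocov_zero]
  have h := autocov_ge_of_changeProb hπ hg hB hp hchange t
  linarith

/-- **`ρ_g(t) ≥ 1 − (2B²p/Var_π g)·t`** when `Var_π g ≠ 0`. -/
theorem acf_ge_of_changeProb (hπ : Kernel.Invariant κ π) {g : Ω → ℝ} (hg : Measurable g)
    {B : ℝ} (hB : ∀ x, |g x| ≤ B) {p : ℝ} (hp : 0 ≤ p)
    (hchange : (π ⊗ₘ κ) {q : Ω × Ω | g q.1 ≠ g q.2} ≤ ENNReal.ofReal p)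
    (hvar : autocov κ π (fun y => g y - ∫ z, g z ∂π) 0 ≠ 0) (t : ℕ) :
    1 - 2 * B ^ 2 * p / autocov κ π (fun y => g y - ∫ z, g z ∂π) 0 * t
      ≤ autocov κ π (fun y => g y - ∫ z, g z ∂π) t
          / autocov κ π (fun y => g y - ∫ z, g z ∂π) 0 := by
  set V := autocov κ π (fun y => g y - ∫ z, g z ∂π) 0 with hV
  have hVnn : 0 ≤ V := by
    rw [hV, autocov_zero]; exact integral_nonneg fun y => by positivity
  have hVpos : 0 < V := lt_of_le_of_ne hVnn (Ne.symm hvar)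
  have h := autocov_centred_ge_of_changeProb hπ hg hB hp hchange t
  rw [← hV] at h
  rw [le_div_iff₀ hVpos]
  have key : (1 - 2 * B ^ 2 * p / V * (t : ℝ)) * V = V - 2 * B ^ 2 * p * t := by
    calc (1 - 2 * B ^ 2 * p / V * (t : ℝ)) * V = V - (2 * B ^ 2 * p * t) * (V / V) := by ring
      _ = V - 2 * B ^ 2 * p * t := by rw [div_self hVpos.ne', mul_one]
  rw [key]
  exact h

/-- **A FROZEN OBSERVABLE DOES NOT AVERAGE**: `Var[ḡ_N] ≥ Var_π g − 2B²p(N² − 1)/(3N)` for the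
stationary chain (`N ≠ 0`, `Var_π g ≠ 0`). -/
theorem variance_timeAverage_ge_of_changeProb (hπ : Kernel.Invariant κ π) {g : Ω → ℝ}
    (hg : Measurable g) {B : ℝ} (hB : ∀ x, |g x| ≤ B) {p : ℝ} (hp : 0 ≤ p)
    (hchange : (π ⊗ₘ κ) {q : Ω × Ω | g q.1 ≠ g q.2} ≤ ENNReal.ofReal p)
    (hvar : autocov κ π (fun y => g y - ∫ z, g z ∂π) 0 ≠ 0) {N : ℕ} (hN : N ≠ 0) :
    autocov κ π (fun y => g y - ∫ z, g z ∂π) 0 - 2 * B ^ 2 * p * ((N : ℝ) ^ 2 - 1) / (3 * N)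
      ≤ Var[fun x : ℕ → Ω => (∑ i ∈ range N, g (x i)) / N;
          Kernel.trajMeasure (X := fun _ : ℕ => Ω) π
            (fun n : ℕ => κ.comap (fun h : (i : ↥(Finset.Iic n)) → Ω => h ⟨n, Finset.mem_Iic.2 le_rfl⟩)
              (measurable_pi_apply _))] := by
  have h := variance_timeAverage_ge_of_acf_linear hπ hg hB hN hvar
    (θ := 2 * B ^ 2 * p / autocov κ π (fun y => g y - ∫ z, g z ∂π) 0)
    (fun t _ _ => acf_ge_of_changeProb hπ hg hB hp hchange hvar t)
  rwa [div_mul_cancel₀ _ hvar] at h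

/-- **… AND LOOKS CONVERGED**: `E_π[v̂_N] ≤ 2B²p(N² − 1)/(3N)` for the sample variance
`v̂_N = (1/N)Σ g(X_t)² − ḡ_N²` of the stationary chain. -/
theorem chain_integral_sampleVariance_le_of_changeProb (hπ : Kernel.Invariant κ π) {g : Ω → ℝ}
    (hg : Measurable g) {B : ℝ} (hB : ∀ x, |g x| ≤ B) {p : ℝ} (hp : 0 ≤ p)
    (hchange : (π ⊗ₘ κ) {q : Ω × Ω | g q.1 ≠ g q.2} ≤ ENNReal.ofReal p)
    (hvar : autocov κ π (fun y => g y - ∫ z, g z ∂π) 0 ≠ 0) {N : ℕ} (hN : N ≠ 0) :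
    ∫ x, ((∑ t ∈ range N, g (x t) ^ 2) / (N : ℝ) - ((∑ t ∈ range N, g (x t)) / (N : ℝ)) ^ 2)
        ∂(Kernel.trajMeasure (X := fun _ : ℕ => Ω) π
          (fun n : ℕ => κ.comap (fun h : (i : ↥(Finset.Iic n)) → Ω => h ⟨n, Finset.mem_Iic.2 le_rfl⟩)
            (measurable_pi_apply _)))
      ≤ 2 * B ^ 2 * p * ((N : ℝ) ^ 2 - 1) / (3 * N) := by
  have h := chain_integral_sampleVariance_le_of_acf_linear hπ hg hB hN hvar
    (θ := 2 * B ^ 2 * p / autocov κ π (fun y => g y - ∫ z, g z ∂π) 0)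
    (fun t _ _ => acf_ge_of_changeProb hπ hg hB hp hchange hvar t)
  rwa [div_mul_cancel₀ _ hvar] at h

end Observable

section Separating

variable {κ : Kernel Ω Ω} [IsMarkovKernel κ] {π : Measure Ω} [IsProbabilityMeasure π]
  {ι : Type*} {R : Ω → Ω → Prop} {Q : Ω → ι} {S : Set Ω} {φ : ι → ℝ}

/-- **TYPED: the estimate of every charge observable freezes** (`S` separates `Q` along the
a.s.-allowed relation `R`, `π` invariant, `|φ ∘ Q| ≤ B` measurable, `Var_π(φ∘Q) ≠ 0`, `N ≠ 0`):
`Var[mean of φ(Q(X_t)), t < N] ≥ Var_π(φ∘Q) − 4B²π(S)(N² − 1)/(3N)`. -/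
theorem variance_timeAverage_ge_of_separating (hS : ∀ ⦃x y⦄, R x y → Q x ≠ Q y → x ∈ S ∨ y ∈ S)
    (hπ : Kernel.Invariant κ π) (hR : ∀ᵐ q ∂(π ⊗ₘ κ), R q.1 q.2)
    (hg : Measurable fun x => φ (Q x)) {B : ℝ} (hB : ∀ x, |φ (Q x)| ≤ B)
    (hvar : autocov κ π (fun y => φ (Q y) - ∫ z, φ (Q z) ∂π) 0 ≠ 0) {N : ℕ} (hN : N ≠ 0) :
    autocov κ π (fun y => φ (Q y) - ∫ z, φ (Q z) ∂π) 0 - 4 * B ^ 2 * π.real S * ((N : ℝ) ^ 2 - 1) / (3 * N)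
      ≤ Var[fun x : ℕ → Ω => (∑ i ∈ range N, φ (Q (x i))) / N;
          Kernel.trajMeasure (X := fun _ : ℕ => Ω) π
            (fun n : ℕ => κ.comap (fun h : (i : ↥(Finset.Iic n)) → Ω => h ⟨n, Finset.mem_Iic.2 le_rfl⟩)
              (measurable_pi_apply _))] := by
  have h := variance_timeAverage_ge_of_changeProb hπ hg hB (by positivity)
    (changeProb_le_of_separating hS hπ hR φ) hvar hN
  have e : 2 * B ^ 2 * (2 * π.real S) = 4 * B ^ 2 * π.real S := by ring
  rwa [e] at h

/-- **TYPED: … and its sample variance is small**: `E_π[v̂_N(φ∘Q)] ≤ 4B²π(S)(N² − 1)/(3N)`. -/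
theorem chain_integral_sampleVariance_le_of_separating
    (hS : ∀ ⦃x y⦄, R x y → Q x ≠ Q y → x ∈ S ∨ y ∈ S)
    (hπ : Kernel.Invariant κ π) (hR : ∀ᵐ q ∂(π ⊗ₘ κ), R q.1 q.2)
    (hg : Measurable fun x => φ (Q x)) {B : ℝ} (hB : ∀ x, |φ (Q x)| ≤ B)
    (hvar : autocov κ π (fun y => φ (Q y) - ∫ z, φ (Q z) ∂π) 0 ≠ 0) {N : ℕ} (hN : N ≠ 0) :
    ∫ x, ((∑ t ∈ range N, φ (Q (x t)) ^ 2) / (N : ℝ) - ((∑ t ∈ range N, φ (Q (x t))) / (N : ℝ)) ^ 2)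
        ∂(Kernel.trajMeasure (X := fun _ : ℕ => Ω) π
          (fun n : ℕ => κ.comap (fun h : (i : ↥(Finset.Iic n)) → Ω => h ⟨n, Finset.mem_Iic.2 le_rfl⟩)
            (measurable_pi_apply _)))
      ≤ 4 * B ^ 2 * π.real S * ((N : ℝ) ^ 2 - 1) / (3 * N) := by
  have h := chain_integral_sampleVariance_le_of_changeProb hπ hg hB (by positivity)
    (changeProb_le_of_separating hS hπ hR φ) hvar hN
  have e : 2 * B ^ 2 * (2 * π.real S) = 4 * B ^ 2 * π.real S := by ring
  rwa [e] at h

end Separating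

end Summit.Ventures.LatticeQCDFlow.Scoring

end
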